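import Mathlib
import Summits.Parity.BatemanHorn.Theses.PolynomialMobius
import Literature.NumberTheory.Sieve.AletheiaZomleferFukshanskyGarcia2020Applications

/-!
# PolyMobiusTail (stmt-Parity-0870) — crux-ideate round 2, ideator 5: NO line filed; rung candidates typed

This file files NO idea card and NO skeleton on the crux. It records, as checked Lean
signatures, the two LADDER RUNG candidates that the lever sweep of this seat isolated
(see `Negative-notes/r2-ideator5-levers.md`, lever L2): statements about `λ(n² + 1)` that sit
STRICTLY BETWEEN the sign-change theorems in print (Teräväinen 2024, Thm 2.3; Srinivasan 2022,
PAMS 150: each sign of `λ(n² + d)` infinitely often — via the Brahmagupta web resp. Pell families,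
both exponentially sparse) and the parity atom of the crux (`PolynomialMobius.PolyChowla` at
`X² + 1`, i.e. `Σ_{n≤x} λ(n²+1) = o(x)`). They do NOT imply the crux and are therefore not a
crux line; they are recorded for the ladder / tenure planners of route PolynomialMobius.

* `ChowlaXSqAddOne`      : the atom at `X² + 1` in Liouville form (an instance of `PolyChowla`);
* `BiasBoundXSqAddOne`   : `∃ δ > 0`, eventually `|Σ_{n≤x} λ(n²+1)| ≤ (1-δ)·x`  (rung R1);
* `SignDensityXSqAddOne` : each sign of `λ(n²+1)` has positive lower density      (rung R1');
* proved placings: `chowlaXSqAddOne_of_polyChowla`, `biasBound_of_chowla`.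
-/

open Filter Finset Polynomial Asymptotics

namespace Summit.Parity.BatemanHorn.Cruxes.PolyMobiusTail.Ideator5

/-- The parity atom of the crux at `X² + 1`, Liouville form. -/
def ChowlaXSqAddOne : Prop :=
  (fun x : ℕ => ∑ n ∈ Icc 1 x, (ArithmeticFunction.liouville (n ^ 2 + 1) : ℝ)) =o[atTop]
    fun x : ℕ => (x : ℝ)

/-- Rung candidate R1 (open; NOT a crux line): the Liouville bias of `n² + 1` is bounded away
from `1`. In print only the infinitude of each sign is known (Teräväinen 2024 Thm 2.3 via the
multiplicative web `g(n)g(n+1) = g(n²+n+1)`; Srinivasan 2022 via Pell families). -/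
def BiasBoundXSqAddOne : Prop :=
  ∃ δ : ℝ, 0 < δ ∧ ∀ᶠ x : ℕ in atTop,
    |∑ n ∈ Icc 1 x, (ArithmeticFunction.liouville (n ^ 2 + 1) : ℝ)| ≤ (1 - δ) * x

/-- Rung candidate R1' (open): each sign of `λ(n² + 1)` is taken on a set of positive lower
density. -/
def SignDensityXSqAddOne : Prop :=
  ∀ v : ℤ, v = 1 ∨ v = -1 → ∃ δ : ℝ, 0 < δ ∧ ∀ᶠ x : ℕ in atTop,
    δ * (x : ℝ) ≤ #((Icc 1 x).filter fun n : ℕ => ArithmeticFunction.liouville (n ^ 2 + 1) = v)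

/-- Placing 1: the route's crux `PolyChowla` (stmt-Parity-0872) contains the atom at `X² + 1`. -/
theorem chowlaXSqAddOne_of_polyChowla (h : Theses.PolynomialMobius.PolyChowla) :
    ChowlaXSqAddOne := by
  have hirr := Literature.NumberTheory.Sieve.irreducible_X_sq_add_one_int
  have hmonic : (X ^ 2 + 1 : ℤ[X]).Monic := monic_X_pow_add_C 1 two_ne_zero
  have hdeg : (X ^ 2 + 1 : ℤ[X]).natDegree = 2 := by
    simpa using natDegree_X_pow_add_C (n := 2) (r := (1 : ℤ))
  have hlc : 0 < (X ^ 2 + 1 : ℤ[X]).leadingCoeff := by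
    rw [hmonic.leadingCoeff]; exact one_pos
  have h2 : 2 ≤ (X ^ 2 + 1 : ℤ[X]).natDegree := by rw [hdeg]
  have := h (X ^ 2 + 1) hirr h2 hlc
  refine this.congr_left fun x => ?_
  refine Finset.sum_congr rfl fun n _ => ?_
  have heval : ((X ^ 2 + 1 : ℤ[X]).eval (n : ℤ)).toNat = n ^ 2 + 1 := by
    simp only [eval_add, eval_pow, eval_X, eval_one]
    norm_cast
  rw [heval]

/-- Placing 2: the atom implies the bias bound (with `δ = 1/2`). -/
theorem biasBound_of_chowla (h : ChowlaXSqAddOne) : BiasBoundXSqAddOne := by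
  refine ⟨1 / 2, by norm_num, ?_⟩
  have := h.def (c := 1 / 2) (by norm_num)
  filter_upwards [this] with x hx
  rw [Real.norm_eq_abs, Real.norm_eq_abs, Nat.abs_cast] at hx
  linarith

end Summit.Parity.BatemanHorn.Cruxes.PolyMobiusTail.Ideator5
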